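import Summits.CriticalPhenomena.PercolationContinuityZ3.Theorems.PercNearOneGluingNoHeavyLowerTailSunflowerTBernFloor
import HarnessLib

/-!
# `NoHeavyLowerTail` (crux stmt-CriticalPhenomena-4575), abstract sunflower cubic: T-BERN — the 3-body endgame from two scalar
# inequalities (O1), (O2), and the scaling of `tcoeff`

Support file (seat `prim-ineq-prove-1` gen 63; `--supports stmt-CriticalPhenomena-4575`).  No `sorry`, no named facts.
Memo: run/shared/lean/prim/prim-ineq-prove-1/FINDING-CONVEX-prove1-g63.md §3, §7.

After the reduction of the memo (§1–§2), T-BERN is the coefficientwise 3-body inequality (normalised floors `(1,1)`)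
  `(α_QX+γ_Q)(α_PX+γ_P)(X+γ_h) ≤_coef (X+1)²(ᾱX+Y)`
for a `u`-heavy hub `P` (`γ_P ≤ α_P`), a γ-heavy virtual pack `Q` (`α_Q ≤ γ_Q`) and an h-petal `(1, γ_h)`, under the g-budget
`γ_Pγ_Qγ_h ≤ Y` and the one-coin bound `A₁ := α_Pγ_Q + α_Qγ_P − γ_Pγ_Q ≤ ᾱ`.  **`coefDom_three_of_opt`**: this follows from the
two SCALAR inequalities
  (O1) `α_Pγ_Q + α_Qγ_P + α_Qα_P(γ_h − 1) ≤ ᾱ + Y`,    (O2) `γ_h(α_Pγ_Q + α_Qγ_P) + Y/γ_h ≤ ᾱ + 2Y`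
(merge `Q` into `P` with the optimal split of the misalignment `Δ = (α_P−γ_P)(γ_Q−α_Q)` between the two coordinates of the virtual
state, then one `coefDom_step` with the h-petal).  Both are equalities at the comparison family and hold numerically (memo §7; (O1) is
proved there except in one sub-case, reduced to the inequality (HC′)).  `tcoeff_scale` is the homogeneity
`tcoeff t (F₁·a) (F₀·c) k = F₁^k F₀^(|t|−k) tcoeff t a c k` that moves between the unnormalised `DomOn` of `…SunflowerTBernFloor`
and normalised coordinates.
-/

noncomputable section

namespace Summit.CriticalPhenomena.PercolationContinuityZ3.Theorems.SunflowerPartition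

namespace SafeCalc

namespace LinkedCurrency

open Finset Polynomial

variable {ι : Type*} [DecidableEq ι]

/-- **Homogeneity of `tcoeff`**: scaling the `X`-coefficients by `F₁` and the constants by `F₀` scales the `k`-th coefficient by
`F₁^k F₀^(|t|−k)`. [this work] -/
theorem tcoeff_scale (t : Finset ι) (a c : ι → ℝ) (F₁ F₀ : ℝ) (k : ℕ) :
    tcoeff t (fun i => F₁ * a i) (fun i => F₀ * c i) k = F₁ ^ k * F₀ ^ (t.card - k) * tcoeff t a c k := by
  unfold tcoeff
  rw [mul_sum]
  refine sum_congr rfl fun S hS => ?_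
  have hSk : S.card = k := (mem_powersetCard.1 hS).2
  have hSs : S ⊆ t := (mem_powersetCard.1 hS).1
  have hcard : (t \ S).card = t.card - k := by rw [card_sdiff_of_subset hSs, hSk]
  rw [prod_mul_distrib, prod_mul_distrib, prod_const, prod_const, hSk, hcard]
  ring

/-- **The 3-body endgame from (O1) and (O2)** (normalised floors).  See the module docstring. [this work] -/
theorem coefDom_three_of_opt {αQ γQ αP γP γh abar Y : ℝ} (hγh : 1 ≤ γh)
    (hPu : γP ≤ αP) (hQg : αQ ≤ γQ) (hA1 : αP * γQ + αQ * γP - γP * γQ ≤ abar) (hbud : γP * γQ * γh ≤ Y)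
    (hO1 : αP * γQ + αQ * γP + αQ * αP * (γh - 1) ≤ abar + Y)
    (hO2 : γh * (γh * (αP * γQ + αQ * γP)) + Y ≤ (abar + 2 * Y) * γh) :
    CoefDom ((C αQ * X + C γQ) * (C αP * X + C γP) * (C 1 * X + C γh))
      ((C 1 * X + C 1) ^ 2 * (C abar * X + C Y)) := by
  have hγh0 : 0 < γh := zero_lt_one.trans_le hγh
  have hΔ : 0 ≤ (αP - γP) * (γQ - αQ) := mul_nonneg (sub_nonneg.2 hPu) (sub_nonneg.2 hQg)
  have hlin : CoefNonneg (C 1 * X + C γh) := coefNonneg_lin zero_le_one hγh0.le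
  have hfl : CoefNonneg (C (1 : ℝ) * X + C 1) := coefNonneg_lin zero_le_one zero_le_one
  -- generic assembly: a merge `(a, c)` of `Q` and `P` that passes the step with `h` gives the claim
  have assemble : ∀ a c : ℝ, αQ * αP ≤ 1 * a → γQ * γP ≤ 1 * c → αQ * γP + γQ * αP ≤ 1 * c + 1 * a →
      a * 1 ≤ 1 * abar → c * γh ≤ 1 * Y → a * γh + c * 1 ≤ 1 * Y + 1 * abar →
      CoefDom ((C αQ * X + C γQ) * (C αP * X + C γP) * (C 1 * X + C γh))
        ((C 1 * X + C 1) ^ 2 * (C abar * X + C Y)) := by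
    intro a c h2 h0 h1 k2 k0 k1
    have step1 : CoefDom ((C αQ * X + C γQ) * (C αP * X + C γP) * (C 1 * X + C γh))
        ((C 1 * X + C 1) * (C a * X + C c) * (C 1 * X + C γh)) := (coefDom_step h2 h0 h1).mul_right hlin
    have step2 : CoefDom ((C 1 * X + C 1) * ((C a * X + C c) * (C 1 * X + C γh)))
        ((C 1 * X + C 1) * ((C 1 * X + C 1) * (C abar * X + C Y))) := (coefDom_step k2 k0 k1).mul_left hfl
    refine (step1.trans (step2.of_eq_left ?_)).of_eq_right ?_
    · ring
    · ring
  by_cases hcase : (αP - γP) * (γQ - αQ) * γh ≤ Y - γP * γQ * γh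
  · -- all the inflation into the `g`-coordinate
    refine assemble (αQ * αP) (γQ * γP + (αP - γP) * (γQ - αQ)) ?_ ?_ ?_ ?_ ?_ ?_
    · rw [one_mul]
    · rw [one_mul]; linarith
    · linarith
    · have : αQ * αP ≤ αP * γQ + αQ * γP - γP * γQ := by nlinarith
      linarith
    · nlinarith
    · nlinarith
  · -- optimal split: the `g`-coordinate saturates the budget, `c·γ_h = Y`
    push Not at hcase
    set c : ℝ := Y / γh with hc
    have hcγ : c * γh = Y := div_mul_cancel₀ Y hγh0.ne'
    refine assemble (αP * γQ + αQ * γP - c) c ?_ ?_ ?_ ?_ ?_ ?_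
    · -- αQ αP ≤ a  ⟺  Y ≤ Γ + Δγ_h  (after multiplying by γ_h > 0)
      have h1 : (αQ * αP + c) * γh ≤ (αP * γQ + αQ * γP) * γh := by
        rw [add_mul, hcγ]; nlinarith
      have h2 := le_of_mul_le_mul_right h1 hγh0
      linarith
    · -- γQ γP ≤ c ⟺ Γ ≤ Y
      have h1 : (γQ * γP) * γh ≤ c * γh := by rw [hcγ]; linarith
      rw [one_mul]; exact le_of_mul_le_mul_right h1 hγh0
    · linarith
    · -- a ≤ ᾱ : a = A₁ − (Y − Γ)/γ_h ≤ A₁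
      have h1 : γP * γQ * γh ≤ c * γh := by rw [hcγ]; exact hbud
      have h2 : γP * γQ ≤ c := le_of_mul_le_mul_right h1 hγh0
      linarith
    · rw [hcγ, one_mul]
    · -- (O2)
      have h1 : ((αP * γQ + αQ * γP - c) * γh + c * 1) * γh ≤ (1 * Y + 1 * abar) * γh := by
        have e : ((αP * γQ + αQ * γP - c) * γh + c * 1) * γh =
            γh * (γh * (αP * γQ + αQ * γP)) - (c * γh) * γh + c * γh := by ring
        rw [e, hcγ]; linarith
      exact le_of_mul_le_mul_right h1 hγh0

end LinkedCurrency

end SafeCalc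

end Summit.CriticalPhenomena.PercolationContinuityZ3.Theorems.SunflowerPartition
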